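import Summits.ResolutionOfSingularities.ResolutionOfSingularities.Theorems.HomologicalConductorNoZenoSelfNodeSepJump
import Summits.ResolutionOfSingularities.ResolutionOfSingularities.Theorems.HomologicalConductorNoZenoNodeBlowupFibrePoints
import HarnessLib

/-!
# Crux `NoZenoR` (stmt-ResolutionOfSingularities-19943), slot 5 `stub_L1wCoreF3`, seam2 (m3) — (HTWO): the DISCHARGE of
# the self-node input `htwo` of res-D-pv-045's `hsplit_upstairs` (p572529)

OURS (cell res-hironaka, chain W4.4; stub worker res-L0-w44-stub-4 g8; object (HTWO) of res-L0-w44-plan-1 DESK WORD 28).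
Nothing here is a statement of the manuscript under review (Hironaka 2017); AI-written, weaker than expert review;
def-free; conditional only on `Lipman1969_13_1_d_rat` (through (S1) = (T1)/(T3)).

In the two stacked squares of `…NoZenoHsplitUpstairs` (`π : X → Spec R`, `σ : X_f → X`, `ρ : X¹ → X` the node blow-up,
`ρ_f : X¹_f → X_f`, `σ¹ : X¹_f → X¹`, here with `X¹_f` a PULLBACK `IsPullback σ¹ ρ_f ρ σ`), over a node `z ∈ sepNodes π`
lying on exactly ONE exceptional curve `η` of `π` and a point `z₁` of `X_f` over `z`:

* `exists_specializes_and_base_eq_of_specializes` — a point `y` of the strict transform `closure {η¹}` over `z`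
  (`ρ` is a closed map);
* **`htwo_discharge`** — the `htwo` clause VERBATIM: `∃ η¹ (y₁ y₂ : X¹_f)`, `η¹ ∈ excCurvePoints (ρ ≫ π)`, `ρ η¹ = η`,
  `y₁ ≠ y₂`, `ρ_f yᵢ = z₁`, `η¹ ⤳ σ¹ yᵢ` — assembled BY NAME from the lift `hlift` (res-L0-w44-stub-3
  `exists_mem_excCurvePoints_apply_eq_and_bijective`), the node curves `hnode` (res-L1-type-o5
  `NodeBlowup.hnode_of_fibre_nontrivial` / `FiniteCentreBlowup.exists_curve_fibre_eq_closure`), (S1)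
  `two_le_finrank_separableClosure_of_selfNode` (p572695), the FIELD STEP `hfibre` «`2 ≤ [κ(y)^s : κ(ρ y)]` ⇒ two primes of
  `κ(y) ⊗[κ(ρ y)] κ(z₁)`» (res-D-pv-039 (S2a) `SplitFibre.exists_two_primes_of_ringHom` p572328 with the closer's splitting
  data — kept as ONE hypothesis in exactly the currency of (S2a-sch)), and (S2a-sch)
  `exists_ne_over_of_isPullback_of_primeSpectrum` (p573084);
* `htwo_discharge_of_inter` — the same with `hfibre` asked only at points lying on TWO DISTINCT exceptional curves of `ρ ≫ π`
  (finitely many; res-D-pv-039's FLAG: the one splitting field of the closer discharges exactly these).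

References: J. Lipman, Publ. Math. IHÉS 36 (1969), §16 (16.1), §24 (p. 258) [`Lipman1969`].
-/

noncomputable section

-- single-problem summit: the doubled namespace component `ResolutionOfSingularities` is forced
set_option linter.dupNamespace false

namespace Summit.ResolutionOfSingularities.ResolutionOfSingularities.Theorems.NoZeno.ExcCount

open CategoryTheory CategoryTheory.Limits AlgebraicGeometry TopologicalSpace IsLocalRing
open Literature.AlgebraicGeometry.Resolution
open scoped TensorProduct

/-- **A point of the strict transform over a given point of the curve downstairs**: for `ρ : X¹ → X` a closed map,
`η¹ ∈ X¹` and `ρ η¹ ⤳ z`, there is `y` with `η¹ ⤳ y` and `ρ y = z`. [folklore] -/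
theorem exists_specializes_and_base_eq_of_specializes {X X1 : Scheme.{0}} (ρ : X1 ⟶ X) (hρ : IsClosedMap ρ.base)
    (η1 : X1) {z : X} (hz : ρ.base η1 ⤳ z) : ∃ y : X1, η1 ⤳ y ∧ ρ.base y = z := by
  have hmem : z ∈ closure (ρ.base '' {η1}) := by
    rw [Set.image_singleton]; exact specializes_iff_mem_closure.mp hz
  obtain ⟨y, hy, hyz⟩ := hρ.closure_image_subset {η1} hmem
  exact ⟨y, specializes_iff_mem_closure.mpr hy, hyz⟩

section Htwo

variable {S : Type} [CommRing S] [IsNoetherianRing S] [IsLocalRing S] [IsDomain S] [IsIntegrallyClosed S]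
  {X X_f X1 X1_f : Scheme.{0}} [IsIntegral X1] [IsLocallyNoetherian X1]
  (π : X ⟶ Spec (.of S)) (σ : X_f ⟶ X) (ρ : X1 ⟶ X) [IsProper ρ] (ρ_f : X1_f ⟶ X_f) (σ1 : X1_f ⟶ X1)

/-- **(HTWO) — the self-node input `htwo` of `hsplit_upstairs`, DISCHARGED.**  For `ρ : X¹ → X` proper with `ρ ≫ π` a
resolution of the RATIONAL two-dimensional normal local domain `S`, `X¹_f` the pullback of `ρ` along `σ : X_f → X`
(`IsPullback σ¹ ρ_f ρ σ`), the node curves `hnode` of `ρ` over `sepNodes π`, the lifts `hlift` of the exceptional curves of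
`π` along `ρ`, and the field step `hfibre` (two primes of `κ(y) ⊗[κ(ρ y)] κ(z₁)` from a separable jump `≥ 2` at `y`): over
every node `z` lying on exactly one exceptional curve `η` of `π` and every `z₁ ∈ X_f` over `z`, there are an exceptional
curve `η¹` of `ρ ≫ π` over `η` and two DISTINCT points `y₁ ≠ y₂` of `X¹_f` over `z₁` with `η¹ ⤳ σ¹ yᵢ`.  Conditional on
`Lipman1969_13_1_d_rat` through (S1). [cite: Lipman1969, §16 (16.1) (p. 231) and §24 (p. 258)] -/
theorem htwo_discharge (h131d : Lipman1969_13_1_d_rat.{0}) (hdim : ringKrullDim S = 2) (hS : HasRationalSingularity S)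
    (hψ : IsResolution (ρ ≫ π)) (hP : IsPullback σ1 ρ_f ρ σ)
    (hnode : ∀ z ∈ sepNodes π, ∃ n ∈ excCurvePoints (ρ ≫ π), ρ.base ⁻¹' {z} = closure {n})
    (hlift : ∀ η ∈ excCurvePoints π, ∃ η1 ∈ excCurvePoints (ρ ≫ π), ρ.base η1 = η ∧ Function.Bijective (ρ.stalkMap η1))
    (hfibre : ∀ (y : X1) (z₁ : X_f) (h : σ.base z₁ = ρ.base y),
      letI : Algebra (X.residueField (ρ.base y)) (X1.residueField y) := (ρ.residueFieldMap y).hom.toAlgebra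
      letI : Algebra (X.residueField (ρ.base y)) (X_f.residueField z₁) :=
        ((X.residueFieldCongr h).inv ≫ σ.residueFieldMap z₁).hom.toAlgebra
      2 ≤ Module.finrank (X.residueField (ρ.base y)) (separableClosure (X.residueField (ρ.base y)) (X1.residueField y)) →
        ∃ q q' : PrimeSpectrum (X1.residueField y ⊗[X.residueField (ρ.base y)] X_f.residueField z₁), q ≠ q') :
    ∀ z ∈ sepNodes π, ∀ η ∈ excCurvePoints π, η ⤳ z → (∀ η' ∈ excCurvePoints π, η' ⤳ z → η' = η) →
      ∀ z₁ : X_f, σ.base z₁ = z → ∃ (η1 : X1) (y₁ y₂ : X1_f), η1 ∈ excCurvePoints (ρ ≫ π) ∧ ρ.base η1 = η ∧ y₁ ≠ y₂ ∧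
        ρ_f.base y₁ = z₁ ∧ ρ_f.base y₂ = z₁ ∧ η1 ⤳ σ1.base y₁ ∧ η1 ⤳ σ1.base y₂ := by
  intro z hz η hη hηz honly z₁ hz₁
  -- the node curve over `z` and the lift of `η`
  obtain ⟨n, hn, hfib⟩ := hnode z hz
  obtain ⟨η1, hη1, hρη1, hbij⟩ := hlift η hη
  have hnz : ρ.base n = z := by
    have : n ∈ ρ.base ⁻¹' {z} := by rw [hfib]; exact subset_closure (Set.mem_singleton n)
    exact this
  -- `η¹ ≠ n`: `ρ η¹ = η` has height one, `ρ n = z` height zero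
  have hne : η1 ≠ n := by
    rintro rfl
    have h0 := height_eq_zero_of_mem_sepNodes π hz
    rw [← hnz, hρη1, hη.2] at h0
    exact one_ne_zero h0
  -- a point `y` of the strict transform over `z`; it lies on the node curve
  obtain ⟨y, hy1, hρy⟩ := exists_specializes_and_base_eq_of_specializes ρ ρ.isClosedMap η1 (hρη1 ▸ hηz)
  have hy2 : n ⤳ y := by
    have : y ∈ ρ.base ⁻¹' {z} := hρy
    rw [hfib] at this
    exact specializes_iff_mem_closure.mpr this
  -- (S1): the separable jump at `y`
  have honly' : ∀ η' ∈ excCurvePoints π, η' ⤳ z → η' = ρ.base η1 := fun η' hη' h' => (honly η' hη' h').trans hρη1.symm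
  have h2 := two_le_finrank_separableClosure_of_selfNode ρ h131d hdim hS hψ hη1 hn hne hy1 hy2 hz hnz hfib.le honly' hbij
  -- (S2a): two primes of `κ(y) ⊗ κ(z₁)`; (S2a-sch): two points of the pullback over `(y, z₁)`
  have hzy : σ.base z₁ = ρ.base y := hz₁.trans hρy.symm
  obtain ⟨y₁, y₂, hne12, h1y, h2y, h1z, h2z⟩ :=
    exists_ne_over_of_isPullback_of_primeSpectrum hP hzy (hfibre y z₁ hzy h2)
  exact ⟨η1, y₁, y₂, hη1, hρη1, hne12, h1z, h2z, h1y ▸ hy1, h2y ▸ hy1⟩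

/-- **(HTWO) with the field step restricted to the FINITELY MANY points lying on two distinct exceptional curves of
`ρ ≫ π`** (res-D-pv-039's FLAG 21:54:56Z: the closer's ONE splitting field serves only finitely many `y`; the proof of
`htwo_discharge` uses `hfibre` only at the point `y` of the strict transform `η¹` AND the node curve `n ≠ η¹`).  Same
conclusion — the `htwo` binder of `hsplit_upstairs` verbatim. [cite: Lipman1969, §16 (16.1) (p. 231) and §24 (p. 258)] -/
theorem htwo_discharge_of_inter (h131d : Lipman1969_13_1_d_rat.{0}) (hdim : ringKrullDim S = 2)
    (hS : HasRationalSingularity S) (hψ : IsResolution (ρ ≫ π)) (hP : IsPullback σ1 ρ_f ρ σ)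
    (hnode : ∀ z ∈ sepNodes π, ∃ n ∈ excCurvePoints (ρ ≫ π), ρ.base ⁻¹' {z} = closure {n})
    (hlift : ∀ η ∈ excCurvePoints π, ∃ η1 ∈ excCurvePoints (ρ ≫ π), ρ.base η1 = η ∧ Function.Bijective (ρ.stalkMap η1))
    (hfibre : ∀ (y : X1) (a b : X1), a ∈ excCurvePoints (ρ ≫ π) → b ∈ excCurvePoints (ρ ≫ π) → a ≠ b → a ⤳ y → b ⤳ y →
      ∀ (z₁ : X_f) (h : σ.base z₁ = ρ.base y),
      letI : Algebra (X.residueField (ρ.base y)) (X1.residueField y) := (ρ.residueFieldMap y).hom.toAlgebra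
      letI : Algebra (X.residueField (ρ.base y)) (X_f.residueField z₁) :=
        ((X.residueFieldCongr h).inv ≫ σ.residueFieldMap z₁).hom.toAlgebra
      2 ≤ Module.finrank (X.residueField (ρ.base y)) (separableClosure (X.residueField (ρ.base y)) (X1.residueField y)) →
        ∃ q q' : PrimeSpectrum (X1.residueField y ⊗[X.residueField (ρ.base y)] X_f.residueField z₁), q ≠ q') :
    ∀ z ∈ sepNodes π, ∀ η ∈ excCurvePoints π, η ⤳ z → (∀ η' ∈ excCurvePoints π, η' ⤳ z → η' = η) →
      ∀ z₁ : X_f, σ.base z₁ = z → ∃ (η1 : X1) (y₁ y₂ : X1_f), η1 ∈ excCurvePoints (ρ ≫ π) ∧ ρ.base η1 = η ∧ y₁ ≠ y₂ ∧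
        ρ_f.base y₁ = z₁ ∧ ρ_f.base y₂ = z₁ ∧ η1 ⤳ σ1.base y₁ ∧ η1 ⤳ σ1.base y₂ := by
  intro z hz η hη hηz honly z₁ hz₁
  obtain ⟨n, hn, hfib⟩ := hnode z hz
  obtain ⟨η1, hη1, hρη1, hbij⟩ := hlift η hη
  have hnz : ρ.base n = z := by
    have : n ∈ ρ.base ⁻¹' {z} := by rw [hfib]; exact subset_closure (Set.mem_singleton n)
    exact this
  have hne : η1 ≠ n := by
    rintro rfl
    have h0 := height_eq_zero_of_mem_sepNodes π hz
    rw [← hnz, hρη1, hη.2] at h0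
    exact one_ne_zero h0
  obtain ⟨y, hy1, hρy⟩ := exists_specializes_and_base_eq_of_specializes ρ ρ.isClosedMap η1 (hρη1 ▸ hηz)
  have hy2 : n ⤳ y := by
    have : y ∈ ρ.base ⁻¹' {z} := hρy
    rw [hfib] at this
    exact specializes_iff_mem_closure.mpr this
  have honly' : ∀ η' ∈ excCurvePoints π, η' ⤳ z → η' = ρ.base η1 := fun η' hη' h' => (honly η' hη' h').trans hρη1.symm
  have h2 := two_le_finrank_separableClosure_of_selfNode ρ h131d hdim hS hψ hη1 hn hne hy1 hy2 hz hnz hfib.le honly' hbij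
  have hzy : σ.base z₁ = ρ.base y := hz₁.trans hρy.symm
  obtain ⟨y₁, y₂, hne12, h1y, h2y, h1z, h2z⟩ :=
    exists_ne_over_of_isPullback_of_primeSpectrum hP hzy (hfibre y η1 n hη1 hn hne hy1 hy2 z₁ hzy h2)
  exact ⟨η1, y₁, y₂, hη1, hρη1, hne12, h1z, h2z, h1y ▸ hy1, h2y ▸ hy1⟩

end Htwo

end Summit.ResolutionOfSingularities.ResolutionOfSingularities.Theorems.NoZeno.ExcCount

end
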